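import Mathlib.Analysis.Calculus.Rademacher
import Mathlib.Analysis.Calculus.BumpFunction.SmoothApprox
import Mathlib.Geometry.Manifold.PartitionOfUnity
import Mathlib.LinearAlgebra.Matrix.PosDef
import Mathlib.MeasureTheory.Function.ContinuousMapDense
import HarnessLib

/-!
# Inverse mean curvature flow I — proofs: weak-* convergence of gradients of equi-Lipschitz
# functions and lower semicontinuity of anisotropic weighted total variations on `ℝⁿ`

The Euclidean engine behind the **Compactness Theorem 2.1** of Huisken–Ilmanen
(J. Differential Geom. 59 (2001), §2, p. 21–22): the step "it follows by lower semicontinuity that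
`∫ φ|∇u|(1 + u − v) ≤ ∫ φ|∇v|`" for locally uniformly convergent, locally equi-Lipschitz
solutions `uᵢ → u`. Read in a chart of a Riemannian manifold, `∫_K w |∇u|_h dμ_h` is the integral
`∫ W(y) √(∑ₖₗ Nᵏˡ(y) ∂ₖû ∂ₗû) dy` of an *anisotropic weighted total variation* of the chart
representative `û` (`Nᵏˡ = hᵏˡ ∘ φ⁻¹` positive definite and continuous, `W = (w ∘ φ⁻¹) √det h ≥ 0`
bounded and compactly supported), and what is needed is its sequential lower semicontinuity under
uniform convergence with uniform Lipschitz bounds. This file proves exactly that, on a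
finite-dimensional real normed space `E` with an additive Haar measure `μ`, by the functional
(duality) argument — no BV theory, no coarea formula:

* `tendsto_integral_lineDeriv_mul_of_lipschitzWith` — **weak-* convergence of directional
  derivatives against Lipschitz test functions**: if `fᵢ, F` are `C`-Lipschitz and `fᵢ → F`
  locally uniformly on an open set `O`, then `∫ ∂ᵥfᵢ g dμ → ∫ ∂ᵥF g dμ` for every compactly
  supported Lipschitz `g` supported in `O` (integration by parts for Lipschitz functions, Mathlib's
  `LipschitzWith.integral_lineDeriv_mul_eq`, the key lemma of Mathlib's proof of Rademacher's
  theorem, moves the derivative onto `g`);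
* `exists_lipschitzWith_integral_sub_le` — **compactly supported Lipschitz functions are dense in
  `L¹`** with control of the support: an integrable `G` vanishing off a compact `K ⊆ O` is
  `L¹`-approximated by Lipschitz functions compactly supported in `O` (continuous compactly
  supported approximation, Mathlib's `Integrable.exists_hasCompactSupport_integral_sub_le`;
  uniform smooth approximation by convolution, Mathlib's `UniformContinuous.exists_contDiff_dist_le`;
  smooth cutoffs);
* `tendsto_integral_lineDeriv_mul`, `tendsto_integral_sum_mul_fderiv` — weak-* convergence of
  `∂ᵥfᵢ` in `σ(L^∞, L¹)` on compact subsets of `O`: against every integrable `G` vanishing off a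
  compact `K ⊆ O`, and in the form `∫ ∑ₖ Gₖ ∂_{bₖ} fᵢ → ∫ ∑ₖ Gₖ ∂_{bₖ} F` for finitely many
  directions;
* `Matrix.PosSemidef.dotProduct_mulVec_sq_le` — the Cauchy–Schwarz inequality
  `(aᵀNc)² ≤ (aᵀNa)(cᵀNc)` for a positive semidefinite real matrix;
* `integral_mul_sqrt_le_of_tendstoLocallyUniformlyOn` — **lower semicontinuity of the
  anisotropic weighted total variation**: for `N` continuous and positive semidefinite on `O`,
  `W ≥ 0` bounded, measurable on and vanishing off a compact `K ⊆ O`, and `fᵢ → F` as above, for every `ε > 0` eventually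
  `∫ W √(∑ₖₗ Nᵏˡ ∂ₖF ∂ₗF) dμ ≤ ∫ W √(∑ₖₗ Nᵏˡ ∂ₖfᵢ ∂ₗfᵢ) dμ + ε`. Proof: with the bounded
  measurable field `ξ = N ∂F / |∂F|_N` one has `W|∂F|_N = W ∑ₖ ξₖ ∂ₖF` pointwise, the weak-*
  convergence gives `∫ W ∑ₖ ξₖ ∂ₖF = lim ∫ W ∑ₖ ξₖ ∂ₖfᵢ`, and `∑ₖ ξₖ ∂ₖfᵢ ≤ |∂fᵢ|_N` pointwise by
  Cauchy–Schwarz (this is the classical proof of the lower semicontinuity of the total variation,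
  Giusti 1984, Thm. 1.9, or Evans–Gariepy 1992, §5.2 Thm. 1, run with the optimal field of the
  limit instead of a supremum over smooth fields).

Everything is proved; there are no definitions and no named facts. The manifold form and
Theorem 2.1 itself are in `InverseMeanCurvatureFlowCompactness.lean`.

## References

* G. Huisken, T. Ilmanen, *The inverse mean curvature flow and the Riemannian Penrose
  inequality*, J. Differential Geom. 59 (2001) 353–437: §2, Compactness Theorem 2.1 and its proof
  ("it follows by lower semicontinuity").
* E. Giusti, *Minimal surfaces and functions of bounded variation*, Birkhäuser 1984, Thm. 1.9
  (semicontinuity of the total variation).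
* L. C. Evans, R. F. Gariepy, *Measure theory and fine properties of functions*, CRC 1992, §5.2,
  Thm. 1; §6.2 (Rademacher; integration by parts for Lipschitz functions).
-/

noncomputable section

open Set Filter MeasureTheory Function Topology
open scoped Topology ENNReal NNReal Matrix Manifold ContDiff

namespace Literature.Geometry.Lorentzian

variable {E : Type*} [NormedAddCommGroup E] [NormedSpace ℝ E] [MeasurableSpace E] [BorelSpace E]
  [FiniteDimensional ℝ E] {μ : Measure E} [μ.IsAddHaarMeasure]

/-! ### Weak-* convergence of directional derivatives against Lipschitz test functions -/

section LipschitzTest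

omit [MeasurableSpace E] [BorelSpace E] [FiniteDimensional ℝ E] in
/-- Off the topological support of `g`, every directional derivative of `g` vanishes. [folklore] -/
theorem lineDeriv_eq_zero_of_notMem_tsupport {g : E → ℝ} {x : E} (hx : x ∉ tsupport g) (v : E) :
    lineDeriv ℝ g x v = 0 := by
  have hg0 : g =ᶠ[𝓝 x] fun _ ↦ 0 := by
    have : ∀ᶠ y in 𝓝 x, y ∉ tsupport g :=
      (isClosed_tsupport g).isOpen_compl.mem_nhds hx
    filter_upwards [this] with y hy using image_eq_zero_of_notMem_tsupport hy
  have hd : DifferentiableAt ℝ g x :=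
    (differentiableAt_const (0 : ℝ)).congr_of_eventuallyEq hg0
  rw [hd.lineDeriv_eq_fderiv, fderiv_of_notMem_tsupport ℝ hx]
  rfl

/-- **Weak-* convergence of directional derivatives of equi-Lipschitz functions, against Lipschitz
test functions.** If `fᵢ` and `F` are `C`-Lipschitz on `E`, `fᵢ → F` locally uniformly on an open
set `O`, and `g` is a compactly supported Lipschitz function with `tsupport g ⊆ O`, then
`∫ ∂ᵥfᵢ · g dμ → ∫ ∂ᵥF · g dμ`. Integration by parts for Lipschitz functions
(`LipschitzWith.integral_lineDeriv_mul_eq`) turns both sides into `∫ ∂₋ᵥg · fᵢ → ∫ ∂₋ᵥg · F`,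
which holds by dominated convergence on the compact `tsupport g`. Evans–Gariepy 1992, §6.2;
this is the convergence used implicitly in Huisken–Ilmanen's "by lower semicontinuity"
(proof of Thm. 2.1). [cite: HuiskenIlmanenIMCF2001, §2 proof of Thm. 2.1] -/
theorem tendsto_integral_lineDeriv_mul_of_lipschitzWith {C D : ℝ≥0} {f : ℕ → E → ℝ} {F : E → ℝ}
    {O : Set E} (hO : IsOpen O) (hf : ∀ i, LipschitzWith C (f i)) (hF : LipschitzWith C F)
    (hconv : TendstoLocallyUniformlyOn f F atTop O) {g : E → ℝ} (hg : LipschitzWith D g)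
    (hgc : HasCompactSupport g) (hgO : tsupport g ⊆ O) (v : E) :
    Tendsto (fun i ↦ ∫ x, lineDeriv ℝ (f i) x v * g x ∂μ) atTop
      (𝓝 (∫ x, lineDeriv ℝ F x v * g x ∂μ)) := by
  simp_rw [LipschitzWith.integral_lineDeriv_mul_eq (hf _) hg hgc,
    LipschitzWith.integral_lineDeriv_mul_eq hF hg hgc]
  -- dominated convergence on the compact support of `g`
  set K := tsupport g with hK
  have hKc : IsCompact K := hgc
  -- `F` is bounded on `K`, and `fᵢ → F` uniformly on `K`
  obtain ⟨M, hM⟩ : ∃ M, ∀ x ∈ K, |F x| ≤ M := by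
    obtain ⟨M, hM⟩ := hKc.exists_bound_of_continuousOn (hF.continuous.continuousOn)
    exact ⟨M, fun x hx ↦ by simpa [Real.norm_eq_abs] using hM x hx⟩
  have hunif : TendstoUniformlyOn f F atTop K :=
    (tendstoLocallyUniformlyOn_iff_forall_isCompact hO).1 hconv K hgO hKc
  have hbound : ∀ᶠ i in atTop, ∀ x ∈ K, |f i x| ≤ M + 1 := by
    have h1 := (Metric.tendstoUniformlyOn_iff.1 hunif) 1 one_pos
    filter_upwards [h1] with i hi x hx
    have h2 : dist (F x) (f i x) < 1 := hi x hx
    rw [Real.dist_eq] at h2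
    have h3 := hM x hx
    have : |f i x| ≤ |F x| + |F x - f i x| := by
      calc |f i x| = |F x - (F x - f i x)| := by ring_nf
        _ ≤ |F x| + |F x - f i x| := abs_sub _ _
    linarith
  -- the derivative of `g` is bounded and vanishes off `K`
  have hDg : ∀ x, |lineDeriv ℝ g x (-v)| ≤ D * ‖v‖ := fun x ↦ by
    have := norm_lineDeriv_le_of_lipschitz ℝ (v := -v) (x₀ := x) hg
    rwa [norm_neg, Real.norm_eq_abs] at this
  have hDg0 : ∀ x ∉ K, lineDeriv ℝ g x (-v) = 0 := fun x hx ↦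
    lineDeriv_eq_zero_of_notMem_tsupport hx (-v)
  have hmeas : ∀ (G : E → ℝ), Continuous G →
      AEStronglyMeasurable (fun x ↦ lineDeriv ℝ g x (-v) * G x) μ := fun G hG ↦
    (aestronglyMeasurable_lineDeriv hg.continuous μ).mul hG.aestronglyMeasurable
  refine tendsto_integral_filter_of_dominated_convergence
    (K.indicator fun _ ↦ D * ‖v‖ * (M + 1)) ?_ ?_ ?_ ?_
  · exact Eventually.of_forall fun i ↦ hmeas _ (hf i).continuous
  · filter_upwards [hbound] with i hi
    refine Eventually.of_forall fun x ↦ ?_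
    by_cases hx : x ∈ K
    · rw [indicator_of_mem hx, norm_mul, Real.norm_eq_abs, Real.norm_eq_abs]
      exact mul_le_mul (hDg x) (hi x hx) (abs_nonneg _) (by positivity)
    · rw [indicator_of_notMem hx, hDg0 x hx, zero_mul, norm_zero]
  · rw [integrable_indicator_iff hKc.measurableSet]
    exact integrableOn_const hKc.measure_lt_top.ne
  · refine Eventually.of_forall fun x ↦ ?_
    by_cases hx : x ∈ K
    · exact ((hunif.tendsto_at hx).const_mul _)
    · simp only [hDg0 x hx, zero_mul]
      exact tendsto_const_nhds

end LipschitzTest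

/-! ### Density of compactly supported Lipschitz functions in `L¹`, with support control -/

section Density

omit [MeasurableSpace E] [BorelSpace E] in
/-- **Smooth cutoffs on a finite-dimensional space**: for `K` compact inside `V` open there is a
`C^∞` function `χ : E → [0, 1]` with `χ = 1` on `K` and `χ = 0` off `V` (Mathlib's smooth Urysohn
lemma `exists_contMDiffMap_zero_one_of_isClosed` on `E` regarded as a manifold). [folklore] -/
theorem exists_contDiff_zero_one_of_isCompact {K V : Set E} (hK : IsCompact K) (hV : IsOpen V)
    (hKV : K ⊆ V) :
    ∃ χ : E → ℝ, ContDiff ℝ ((⊤ : ℕ∞) : WithTop ℕ∞) χ ∧ (∀ x ∈ K, χ x = 1) ∧ (∀ x ∉ V, χ x = 0) ∧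
      ∀ x, χ x ∈ Icc (0 : ℝ) 1 := by
  have hd : Disjoint Vᶜ K := disjoint_compl_left_iff.2 hKV
  obtain ⟨f, hf0, hf1, hf⟩ := exists_contMDiffMap_zero_one_of_isClosed (I := 𝓘(ℝ, E)) (M := E)
    (n := (⊤ : ℕ∞)) hV.isClosed_compl hK.isClosed hd
  refine ⟨f, f.contMDiff.contDiff, fun x hx ↦ hf1 hx, fun x hx ↦ hf0 hx, hf⟩

omit [NormedSpace ℝ E] [MeasurableSpace E] [BorelSpace E] [FiniteDimensional ℝ E] in
/-- A function vanishing off `V` has topological support inside `closure V`. [folklore] -/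
theorem tsupport_subset_closure_of_eq_zero {g : E → ℝ} {V : Set E} (hg : ∀ x ∉ V, g x = 0) :
    tsupport g ⊆ closure V :=
  closure_mono fun x hx ↦ by_contra fun hxV ↦ hx (hg x hxV)

/-- **Compactly supported Lipschitz functions are dense in `L¹`, with control of the support.**
If `G` is integrable and vanishes off a compact set `K` contained in the open set `O`, then for
every `ε > 0` there is a Lipschitz function `g` with compact support inside `O` and
`∫ |G − g| dμ ≤ ε`. (Continuous compactly supported functions are dense in `L¹`,
`Integrable.exists_hasCompactSupport_integral_sub_le`; a continuous compactly supported function is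
uniformly continuous, hence uniformly approximated by smooth functions,
`UniformContinuous.exists_contDiff_dist_le`; smooth cutoffs localise the supports; a compactly
supported `C¹` function is Lipschitz.) Evans–Gariepy 1992, §4.2, Thm. 1 (density of `C_c^∞`).
[folklore] -/
theorem exists_lipschitzWith_integral_sub_le {G : E → ℝ} {K O : Set E} (hK : IsCompact K)
    (hO : IsOpen O) (hKO : K ⊆ O) (hG : Integrable G μ) (hGK : ∀ x ∉ K, G x = 0) {ε : ℝ}
    (hε : 0 < ε) :
    ∃ g : E → ℝ, (∃ D, LipschitzWith D g) ∧ HasCompactSupport g ∧ tsupport g ⊆ O ∧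
      Integrable g μ ∧ ∫ x, |G x - g x| ∂μ ≤ ε := by
  -- nested relatively compact open sets `K ⊆ V ⊆ closure V ⊆ V' ⊆ closure V' ⊆ O`
  obtain ⟨V, hVo, hKV, hVO, hVc⟩ := exists_open_between_and_isCompact_closure hK hO hKO
  obtain ⟨V', hV'o, hVV', hV'O, hV'c⟩ := exists_open_between_and_isCompact_closure hVc hO hVO
  -- smooth cutoffs `χ = 1` on `K`, `χ = 0` off `V`; `χ' = 1` on `closure V`, `χ' = 0` off `V'`
  obtain ⟨χ, hχs, hχ1, hχ0, hχ01⟩ := exists_contDiff_zero_one_of_isCompact hK hVo hKV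
  obtain ⟨χ', hχ's, hχ'1, hχ'0, hχ'01⟩ := exists_contDiff_zero_one_of_isCompact hVc hV'o hVV'
  have hχc : HasCompactSupport χ :=
    HasCompactSupport.of_support_subset_isCompact hVc
      ((subset_tsupport χ).trans (tsupport_subset_closure_of_eq_zero hχ0))
  have hχ'c : HasCompactSupport χ' :=
    HasCompactSupport.of_support_subset_isCompact hV'c
      ((subset_tsupport χ').trans (tsupport_subset_closure_of_eq_zero hχ'0))
  -- step 1: a continuous compactly supported `g₁` with `∫ |G - g₁| ≤ ε / 2`, cut off to `g₂ = χ g₁`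
  obtain ⟨g₁, hg₁c, hg₁, hg₁cont, hg₁i⟩ := hG.exists_hasCompactSupport_integral_sub_le (half_pos hε)
  set g₂ : E → ℝ := fun x ↦ χ x * g₁ x with hg₂
  have hg₂cont : Continuous g₂ := hχs.continuous.mul hg₁cont
  have hg₂c : HasCompactSupport g₂ := hg₁c.mul_left
  have hg₂i : Integrable g₂ μ := hg₂cont.integrable_of_hasCompactSupport hg₂c
  have hGg₂ : ∀ x, |G x - g₂ x| ≤ |G x - g₁ x| := by
    intro x
    by_cases hx : x ∈ K
    · simp [hg₂, hχ1 x hx]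
    · rw [hGK x hx, zero_sub, zero_sub, abs_neg, abs_neg, hg₂, abs_mul]
      have h01 := hχ01 x
      calc |χ x| * |g₁ x| ≤ 1 * |g₁ x| := by
            gcongr; rw [abs_of_nonneg h01.1]; exact h01.2
        _ = |g₁ x| := one_mul _
  have h1 : ∫ x, |G x - g₂ x| ∂μ ≤ ε / 2 := by
    refine (integral_mono_of_nonneg (Eventually.of_forall fun x ↦ abs_nonneg _) ?_
      (Eventually.of_forall hGg₂)).trans ?_
    · exact (hG.sub hg₁i).norm
    · simpa [Real.norm_eq_abs] using hg₁
  -- step 2: `g₂` is uniformly continuous; approximate uniformly by a smooth `G₃`, cut off by `χ'`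
  have hg₂u : UniformContinuous g₂ :=
    hg₂cont.uniformContinuous_of_tendsto_cocompact hg₂c.is_zero_at_infty
  have hμV' : μ (closure V') < ⊤ := hV'c.measure_lt_top
  set δ : ℝ := ε / (2 * (μ.real (closure V') + 1)) with hδ
  have hmpos : 0 < μ.real (closure V') + 1 := by positivity
  have hδpos : 0 < δ := by rw [hδ]; positivity
  obtain ⟨G₃, hG₃s, hG₃⟩ := hg₂u.exists_contDiff_dist_le hδpos
  set g : E → ℝ := fun x ↦ χ' x * G₃ x with hgdef
  have hgs : ContDiff ℝ ((⊤ : ℕ∞) : WithTop ℕ∞) g := hχ's.mul hG₃s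
  have hgc : HasCompactSupport g := hχ'c.mul_right
  have hgi : Integrable g μ := hgs.continuous.integrable_of_hasCompactSupport hgc
  obtain ⟨D, hD⟩ := hgs.lipschitzWith_of_hasCompactSupport hgc (by simp)
  have hgO : tsupport g ⊆ O := by
    refine (closure_mono fun x hx ↦ ?_).trans ((tsupport_subset_closure_of_eq_zero hχ'0).trans hV'O)
    exact fun hx' ↦ hx (by simp [hgdef, hx'])
  -- `|g₂ - g| ≤ δ` on `closure V'` and `= 0` off it
  have hg₂g : ∀ x, |g₂ x - g x| ≤ (closure V').indicator (fun _ ↦ δ) x := by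
    intro x
    have hχ'g₂ : g₂ x = χ' x * g₂ x := by
      by_cases hx : x ∈ V
      · rw [hχ'1 x (subset_closure hx), one_mul]
      · simp [hg₂, hχ0 x hx]
    rw [hχ'g₂, hgdef, ← mul_sub, abs_mul]
    by_cases hx : x ∈ closure V'
    · rw [indicator_of_mem hx]
      have h01 := hχ'01 x
      have h3 : |g₂ x - G₃ x| ≤ δ := by
        rw [abs_sub_comm]; exact (Real.dist_eq (G₃ x) (g₂ x) ▸ (hG₃ x)).le
      calc |χ' x| * |g₂ x - G₃ x| ≤ 1 * δ := by
            refine mul_le_mul ?_ h3 (abs_nonneg _) zero_le_one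
            rw [abs_of_nonneg h01.1]; exact h01.2
        _ = δ := one_mul δ
    · rw [indicator_of_notMem hx, hχ'0 x (fun hx' ↦ hx (subset_closure hx')), abs_zero, zero_mul]
  have h2 : ∫ x, |g₂ x - g x| ∂μ ≤ ε / 2 := by
    have hind : Integrable ((closure V').indicator fun _ ↦ δ) μ := by
      rw [integrable_indicator_iff isClosed_closure.measurableSet]
      exact integrableOn_const hμV'.ne
    calc ∫ x, |g₂ x - g x| ∂μ ≤ ∫ x, (closure V').indicator (fun _ ↦ δ) x ∂μ :=
          integral_mono_of_nonneg (Eventually.of_forall fun x ↦ abs_nonneg _) hind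
            (Eventually.of_forall hg₂g)
      _ = δ * μ.real (closure V') := by
          rw [integral_indicator isClosed_closure.measurableSet, setIntegral_const, smul_eq_mul,
            mul_comm]
      _ ≤ δ * (μ.real (closure V') + 1) := by gcongr; linarith
      _ = ε / 2 := by rw [hδ]; field_simp
  -- conclusion
  refine ⟨g, ⟨D, hD⟩, hgc, hgO, hgi, ?_⟩
  have hle : ∀ x, |G x - g x| ≤ |G x - g₂ x| + |g₂ x - g x| := fun x ↦ by
    calc |G x - g x| = |(G x - g₂ x) + (g₂ x - g x)| := by ring_nf
      _ ≤ |G x - g₂ x| + |g₂ x - g x| := abs_add_le _ _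
  calc ∫ x, |G x - g x| ∂μ ≤ ∫ x, (|G x - g₂ x| + |g₂ x - g x|) ∂μ :=
        integral_mono_of_nonneg (Eventually.of_forall fun x ↦ abs_nonneg _)
          ((hG.sub hg₂i).norm.add (hg₂i.sub hgi).norm) (Eventually.of_forall hle)
    _ = ∫ x, |G x - g₂ x| ∂μ + ∫ x, |g₂ x - g x| ∂μ :=
        integral_add (hG.sub hg₂i).norm (hg₂i.sub hgi).norm
    _ ≤ ε / 2 + ε / 2 := add_le_add h1 h2
    _ = ε := add_halves ε

end Density

/-! ### Weak-* convergence of directional derivatives against integrable test functions -/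

section WeakStar

omit [MeasurableSpace E] [BorelSpace E] [FiniteDimensional ℝ E] in
/-- The directional derivatives of a `C`-Lipschitz function are bounded by `C ‖v‖`. [folklore] -/
theorem abs_lineDeriv_le_of_lipschitzWith {C : ℝ≥0} {f : E → ℝ} (hf : LipschitzWith C f) (x v : E) :
    |lineDeriv ℝ f x v| ≤ C * ‖v‖ := by
  have := norm_lineDeriv_le_of_lipschitz ℝ (v := v) (x₀ := x) hf
  rwa [Real.norm_eq_abs] at this

omit [FiniteDimensional ℝ E] [μ.IsAddHaarMeasure] in
/-- For a `C`-Lipschitz `f` and an integrable `G`, `x ↦ ∂ᵥf(x) G(x)` is integrable. [folklore] -/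
theorem integrable_lineDeriv_mul {C : ℝ≥0} {f : E → ℝ} (hf : LipschitzWith C f) {G : E → ℝ}
    (hG : Integrable G μ) (v : E) :
    Integrable (fun x ↦ lineDeriv ℝ f x v * G x) μ := by
  refine hG.bdd_mul (c := C * ‖v‖) (aestronglyMeasurable_lineDeriv hf.continuous μ) ?_
  exact Eventually.of_forall fun x ↦ by
    rw [Real.norm_eq_abs]; exact abs_lineDeriv_le_of_lipschitzWith hf x v

omit [FiniteDimensional ℝ E] [μ.IsAddHaarMeasure] in
/-- `|∫ ∂ᵥf (G − g)| ≤ C ‖v‖ ∫ |G − g|` for `f` `C`-Lipschitz. [folklore] -/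
theorem abs_integral_lineDeriv_mul_sub_le {C : ℝ≥0} {f : E → ℝ} (hf : LipschitzWith C f)
    {G g : E → ℝ} (hG : Integrable G μ) (hg : Integrable g μ) (v : E) :
    |(∫ x, lineDeriv ℝ f x v * G x ∂μ) - ∫ x, lineDeriv ℝ f x v * g x ∂μ| ≤
      C * ‖v‖ * ∫ x, |G x - g x| ∂μ := by
  rw [← integral_sub (integrable_lineDeriv_mul hf hG v) (integrable_lineDeriv_mul hf hg v)]
  calc |∫ x, (lineDeriv ℝ f x v * G x - lineDeriv ℝ f x v * g x) ∂μ|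
      ≤ ∫ x, |lineDeriv ℝ f x v * G x - lineDeriv ℝ f x v * g x| ∂μ := by
        simpa only [Real.norm_eq_abs] using
          norm_integral_le_integral_norm (fun x ↦ lineDeriv ℝ f x v * G x - lineDeriv ℝ f x v * g x)
    _ ≤ ∫ x, C * ‖v‖ * |G x - g x| ∂μ := by
        refine integral_mono_of_nonneg (Eventually.of_forall fun x ↦ abs_nonneg _)
          ((hG.sub hg).norm.const_mul _) (Eventually.of_forall fun x ↦ ?_)
        simp only
        rw [← mul_sub, abs_mul]
        exact mul_le_mul_of_nonneg_right (abs_lineDeriv_le_of_lipschitzWith hf x v) (abs_nonneg _)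
    _ = C * ‖v‖ * ∫ x, |G x - g x| ∂μ := integral_const_mul _ _

/-- **Weak-* convergence of directional derivatives of equi-Lipschitz functions on compact subsets.**
If `fᵢ, F` are `C`-Lipschitz, `fᵢ → F` locally uniformly on the open set `O`, and `G` is
integrable and vanishes off a compact `K ⊆ O`, then `∫ ∂ᵥfᵢ G dμ → ∫ ∂ᵥF G dμ`: the bounded
sequence `∂ᵥfᵢ` converges weak-* in `L^∞(K)` to `∂ᵥF` (Lipschitz test functions,
`tendsto_integral_lineDeriv_mul_of_lipschitzWith`, are `L¹`-dense,
`exists_lipschitzWith_integral_sub_le`, and `|∂ᵥfᵢ| ≤ C‖v‖` uniformly). Evans–Gariepy 1992, §6.2;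
the convergence behind Huisken–Ilmanen's "by lower semicontinuity" (proof of Thm. 2.1).
[cite: HuiskenIlmanenIMCF2001, §2 proof of Thm. 2.1] -/
theorem tendsto_integral_lineDeriv_mul {C : ℝ≥0} {f : ℕ → E → ℝ} {F : E → ℝ} {O K : Set E}
    (hO : IsOpen O) (hK : IsCompact K) (hKO : K ⊆ O) (hf : ∀ i, LipschitzWith C (f i))
    (hF : LipschitzWith C F) (hconv : TendstoLocallyUniformlyOn f F atTop O) {G : E → ℝ}
    (hG : Integrable G μ) (hGK : ∀ x ∉ K, G x = 0) (v : E) :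
    Tendsto (fun i ↦ ∫ x, lineDeriv ℝ (f i) x v * G x ∂μ) atTop
      (𝓝 (∫ x, lineDeriv ℝ F x v * G x ∂μ)) := by
  rw [Metric.tendsto_atTop]
  intro ε hε
  -- a Lipschitz test function `g` with `C ‖v‖ ∫ |G - g| ≤ ε / 3`
  have hc : 0 < (C : ℝ) * ‖v‖ + 1 := by positivity
  obtain ⟨g, ⟨D, hg⟩, hgc, hgO, hgi, hGg⟩ := exists_lipschitzWith_integral_sub_le (μ := μ) hK hO
    hKO hG hGK (ε := ε / (3 * ((C : ℝ) * ‖v‖ + 1))) (by positivity)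
  have herr : (C : ℝ) * ‖v‖ * ∫ x, |G x - g x| ∂μ ≤ ε / 3 := by
    calc (C : ℝ) * ‖v‖ * ∫ x, |G x - g x| ∂μ ≤ ((C : ℝ) * ‖v‖ + 1) * (ε / (3 * ((C : ℝ) * ‖v‖ + 1))) := by
          refine mul_le_mul (by linarith) hGg (integral_nonneg fun x ↦ abs_nonneg _) hc.le
      _ = ε / 3 := by field_simp
  have hlim := (Metric.tendsto_atTop.1
    (tendsto_integral_lineDeriv_mul_of_lipschitzWith (μ := μ) hO hf hF hconv hg hgc hgO v))
    (ε / 3) (by positivity)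
  obtain ⟨N, hN⟩ := hlim
  refine ⟨N, fun i hi ↦ ?_⟩
  have h1 := abs_integral_lineDeriv_mul_sub_le (μ := μ) (hf i) hG hgi v
  have h2 := abs_integral_lineDeriv_mul_sub_le (μ := μ) hF hG hgi v
  have h3 := hN i hi
  rw [Real.dist_eq] at h3 ⊢
  -- triangle inequality
  have key : ∀ a b c d : ℝ, |a - d| ≤ |a - b| + |b - c| + |c - d| := fun a b c d ↦ by
    calc |a - d| ≤ |a - b| + |b - d| := abs_sub_le a b d
      _ ≤ |a - b| + (|b - c| + |c - d|) := by gcongr; exact abs_sub_le b c d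
      _ = |a - b| + |b - c| + |c - d| := by ring
  have key' := key (∫ x, lineDeriv ℝ (f i) x v * G x ∂μ) (∫ x, lineDeriv ℝ (f i) x v * g x ∂μ)
    (∫ x, lineDeriv ℝ F x v * g x ∂μ) (∫ x, lineDeriv ℝ F x v * G x ∂μ)
  rw [abs_sub_comm] at h2
  linarith

/-- **Weak-* convergence of gradients, coordinate form.** Under the hypotheses of
`tendsto_integral_lineDeriv_mul`, for finitely many directions `bₖ` and integrable `Gₖ` vanishing
off the compact `K ⊆ O`, `∫ ∑ₖ Gₖ ∂_{bₖ}fᵢ dμ → ∫ ∑ₖ Gₖ ∂_{bₖ}F dμ`, with the partial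
derivatives written as Fréchet derivatives `D fᵢ(x) bₖ` (which agree with the line derivatives at
the points of differentiability, i.e. `μ`-a.e. by Rademacher's theorem).
[cite: HuiskenIlmanenIMCF2001, §2 proof of Thm. 2.1] -/
theorem tendsto_integral_sum_mul_fderiv {C : ℝ≥0} {f : ℕ → E → ℝ} {F : E → ℝ} {O K : Set E}
    (hO : IsOpen O) (hK : IsCompact K) (hKO : K ⊆ O) (hf : ∀ i, LipschitzWith C (f i))
    (hF : LipschitzWith C F) (hconv : TendstoLocallyUniformlyOn f F atTop O)
    {ι : Type*} [Fintype ι] (b : ι → E) {G : ι → E → ℝ} (hG : ∀ k, Integrable (G k) μ)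
    (hGK : ∀ k, ∀ x ∉ K, G k x = 0) :
    Tendsto (fun i ↦ ∫ x, ∑ k, G k x * fderiv ℝ (f i) x (b k) ∂μ) atTop
      (𝓝 (∫ x, ∑ k, G k x * fderiv ℝ F x (b k) ∂μ)) := by
  -- replace Fréchet by line derivatives, a.e.
  have hae : ∀ {φ : E → ℝ}, LipschitzWith C φ →
      (fun x ↦ ∑ k, G k x * fderiv ℝ φ x (b k)) =ᵐ[μ] fun x ↦ ∑ k, lineDeriv ℝ φ x (b k) * G k x := by
    intro φ hφ
    filter_upwards [hφ.ae_differentiableAt (μ := μ)] with x hx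
    refine Finset.sum_congr rfl fun k _ ↦ ?_
    rw [hx.lineDeriv_eq_fderiv, mul_comm]
  have hint : ∀ {φ : E → ℝ}, LipschitzWith C φ →
      ∫ x, ∑ k, G k x * fderiv ℝ φ x (b k) ∂μ = ∑ k, ∫ x, lineDeriv ℝ φ x (b k) * G k x ∂μ := by
    intro φ hφ
    rw [integral_congr_ae (hae hφ), integral_finsetSum]
    exact fun k _ ↦ integrable_lineDeriv_mul hφ (hG k) (b k)
  simp_rw [hint (hf _), hint hF]
  exact tendsto_finsetSum _ fun k _ ↦
    tendsto_integral_lineDeriv_mul hO hK hKO hf hF hconv (hG k) (hGK k) (b k)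

end WeakStar

/-! ### Cauchy–Schwarz for positive semidefinite matrices -/

section CauchySchwarz

variable {ι : Type*} [Fintype ι]

/-- For a real symmetric matrix, `a ⬝ᵥ (N *ᵥ c) = c ⬝ᵥ (N *ᵥ a)`. [folklore] -/
theorem dotProduct_mulVec_comm_of_isHermitian {N : Matrix ι ι ℝ} (hN : N.IsHermitian)
    (a c : ι → ℝ) : a ⬝ᵥ (N *ᵥ c) = c ⬝ᵥ (N *ᵥ a) := by
  have hT : Nᵀ = N := by
    have h1 := hN.eq
    rwa [Matrix.conjTranspose_eq_transpose_of_trivial] at h1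
  rw [Matrix.dotProduct_mulVec, ← Matrix.mulVec_transpose, hT, dotProduct_comm]

/-- **Cauchy–Schwarz for a positive semidefinite real matrix**:
`(aᵀ N c)² ≤ (aᵀ N a) (cᵀ N c)` (discriminant of `t ↦ (a + tc)ᵀ N (a + tc) ≥ 0`). [folklore] -/
theorem _root_.Matrix.PosSemidef.dotProduct_mulVec_sq_le {N : Matrix ι ι ℝ} (hN : N.PosSemidef)
    (a c : ι → ℝ) :
    (a ⬝ᵥ (N *ᵥ c)) ^ 2 ≤ (a ⬝ᵥ (N *ᵥ a)) * (c ⬝ᵥ (N *ᵥ c)) := by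
  have hsymm := dotProduct_mulVec_comm_of_isHermitian hN.1 c a
  have hquad : ∀ t : ℝ, 0 ≤ (c ⬝ᵥ (N *ᵥ c)) * (t * t) + (2 * (a ⬝ᵥ (N *ᵥ c))) * t + a ⬝ᵥ (N *ᵥ a) := by
    intro t
    have h0 := hN.dotProduct_mulVec_nonneg (a + t • c)
    rw [star_trivial, Matrix.mulVec_add, Matrix.mulVec_smul, dotProduct_add, add_dotProduct,
      add_dotProduct, dotProduct_smul, dotProduct_smul, smul_dotProduct, smul_dotProduct,
      hsymm] at h0
    simp only [smul_eq_mul] at h0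
    nlinarith [h0]
  have hd := discrim_le_zero hquad
  rw [discrim] at hd
  nlinarith [hd]

/-- The double sum `∑ₗ ∑ₖ Nₖₗ aₖ cₗ` is the bilinear form `aᵀ N c`. [folklore] -/
theorem sum_sum_mul_mul_eq_dotProduct_mulVec (N : Matrix ι ι ℝ) (a c : ι → ℝ) :
    ∑ l, ∑ k, N k l * a k * c l = a ⬝ᵥ (N *ᵥ c) := by
  simp only [dotProduct, Matrix.mulVec, Finset.mul_sum]
  rw [Finset.sum_comm]
  refine Finset.sum_congr rfl fun k _ ↦ Finset.sum_congr rfl fun l _ ↦ ?_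
  ring

/-- Cauchy–Schwarz in double-sum form: `(∑ₖₗ Nₖₗ aₖ cₗ)² ≤ (∑ₖₗ Nₖₗ aₖ aₗ)(∑ₖₗ Nₖₗ cₖ cₗ)` for `N`
positive semidefinite. [folklore] -/
theorem _root_.Matrix.PosSemidef.sum_sum_mul_mul_sq_le {N : Matrix ι ι ℝ} (hN : N.PosSemidef)
    (a c : ι → ℝ) :
    (∑ l, ∑ k, N k l * a k * c l) ^ 2 ≤
      (∑ l, ∑ k, N k l * a k * a l) * (∑ l, ∑ k, N k l * c k * c l) := by
  simp only [sum_sum_mul_mul_eq_dotProduct_mulVec]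
  exact hN.dotProduct_mulVec_sq_le a c

/-- The quadratic form of a positive semidefinite matrix is nonnegative, double-sum form.
[folklore] -/
theorem _root_.Matrix.PosSemidef.sum_sum_mul_mul_nonneg {N : Matrix ι ι ℝ} (hN : N.PosSemidef)
    (a : ι → ℝ) : 0 ≤ ∑ l, ∑ k, N k l * a k * a l := by
  rw [sum_sum_mul_mul_eq_dotProduct_mulVec]
  simpa only [star_trivial] using hN.dotProduct_mulVec_nonneg a

/-- `∑ₗ ∑ₖ Nₖₗ aₖ cₗ = ∑ₗ ∑ₖ Nₖₗ cₖ aₗ` for `N` symmetric. [folklore] -/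
theorem sum_sum_mul_mul_comm_of_isHermitian {N : Matrix ι ι ℝ} (hN : N.IsHermitian)
    (a c : ι → ℝ) : ∑ l, ∑ k, N k l * a k * c l = ∑ l, ∑ k, N k l * c k * a l := by
  rw [sum_sum_mul_mul_eq_dotProduct_mulVec, sum_sum_mul_mul_eq_dotProduct_mulVec,
    dotProduct_mulVec_comm_of_isHermitian hN]

/-- The "gradient field" coefficient bound: for `N` positive semidefinite,
`(∑ₗ Nₖₗ aₗ)² ≤ Nₖₖ · ∑ₗ ∑ₖ' Nₖ'ₗ aₖ' aₗ` (Cauchy–Schwarz against the `k`-th basis vector).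
[folklore] -/
theorem _root_.Matrix.PosSemidef.sum_mul_sq_le [DecidableEq ι] {N : Matrix ι ι ℝ}
    (hN : N.PosSemidef) (a : ι → ℝ) (k : ι) :
    (∑ l, N k l * a l) ^ 2 ≤ N k k * ∑ l, ∑ k', N k' l * a k' * a l := by
  have h1 := hN.dotProduct_mulVec_sq_le (Pi.single k 1) a
  have h2 : Pi.single (M := fun _ ↦ ℝ) k 1 ⬝ᵥ (N *ᵥ a) = ∑ l, N k l * a l := by
    rw [dotProduct_comm, dotProduct_single, mul_one]
    rfl
  have h3 : Pi.single (M := fun _ ↦ ℝ) k 1 ⬝ᵥ (N *ᵥ Pi.single k 1) = N k k := by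
    rw [dotProduct_comm, dotProduct_single, mul_one, Matrix.mulVec_single_one]
    rfl
  rw [h2, h3, ← sum_sum_mul_mul_eq_dotProduct_mulVec] at h1
  exact h1

/-- **The optimal field realises the `N`-norm**: with `s = √(aᵀNa)` and `ξₖ = (Na)ₖ / s`,
`∑ₖ ξₖ aₖ = s` (for `N` positive semidefinite; both sides vanish when `s = 0`). [folklore] -/
theorem _root_.Matrix.PosSemidef.sum_div_sqrt_mul_self {N : Matrix ι ι ℝ} (hN : N.PosSemidef)
    (a : ι → ℝ) :
    ∑ k, (∑ l, N k l * a l) / Real.sqrt (∑ l, ∑ k, N k l * a k * a l) * a k =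
      Real.sqrt (∑ l, ∑ k, N k l * a k * a l) := by
  set q := ∑ l, ∑ k, N k l * a k * a l with hq
  have hq0 : 0 ≤ q := hN.sum_sum_mul_mul_nonneg a
  by_cases hs : Real.sqrt q = 0
  · simp [hs]
  · have hsum : ∑ k, (∑ l, N k l * a l) / Real.sqrt q * a k = q / Real.sqrt q := by
      rw [hq, Finset.sum_comm, Finset.sum_div]
      refine Finset.sum_congr rfl fun k _ ↦ ?_
      rw [Finset.sum_div, Finset.sum_mul, Finset.sum_div]
      refine Finset.sum_congr rfl fun l _ ↦ ?_
      ring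
    rw [hsum, div_eq_iff hs, ← Real.sqrt_mul_self hq0]
    rw [Real.sqrt_mul_self hq0, Real.mul_self_sqrt hq0]

/-- **The optimal field is a sub-calibration**: with `ξₖ = (Na)ₖ / √(aᵀNa)`, for every `c`,
`∑ₖ ξₖ cₖ ≤ √(cᵀNc)` (Cauchy–Schwarz). [folklore] -/
theorem _root_.Matrix.PosSemidef.sum_div_sqrt_mul_le {N : Matrix ι ι ℝ} (hN : N.PosSemidef)
    (a c : ι → ℝ) :
    ∑ k, (∑ l, N k l * a l) / Real.sqrt (∑ l, ∑ k, N k l * a k * a l) * c k ≤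
      Real.sqrt (∑ l, ∑ k, N k l * c k * c l) := by
  set q := ∑ l, ∑ k, N k l * a k * a l with hq
  set r := ∑ l, ∑ k, N k l * c k * c l with hr
  have hq0 : 0 ≤ q := hN.sum_sum_mul_mul_nonneg a
  have hr0 : 0 ≤ r := hN.sum_sum_mul_mul_nonneg c
  by_cases hs : Real.sqrt q = 0
  · simp only [hs, div_zero, zero_mul, Finset.sum_const_zero]
    exact Real.sqrt_nonneg _
  · have hspos : 0 < Real.sqrt q := lt_of_le_of_ne (Real.sqrt_nonneg _) (Ne.symm hs)
    have hsum : ∑ k, (∑ l, N k l * a l) / Real.sqrt q * c k =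
        (∑ l, ∑ k, N k l * c k * a l) / Real.sqrt q := by
      rw [Finset.sum_comm, Finset.sum_div]
      refine Finset.sum_congr rfl fun k _ ↦ ?_
      rw [Finset.sum_div, Finset.sum_mul, Finset.sum_div]
      refine Finset.sum_congr rfl fun l _ ↦ ?_
      ring
    rw [hsum, div_le_iff₀ hspos]
    have hcs := hN.sum_sum_mul_mul_sq_le c a
    rw [← hr, ← hq] at hcs
    have h1 : |∑ l, ∑ k, N k l * c k * a l| ≤ Real.sqrt r * Real.sqrt q := by
      rw [← Real.sqrt_sq_eq_abs, ← Real.sqrt_mul hr0]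
      exact Real.sqrt_le_sqrt hcs
    exact (le_abs_self _).trans h1

/-- **The optimal field is bounded**: `|(Na)ₖ / √(aᵀNa)| ≤ √Nₖₖ`. [folklore] -/
theorem _root_.Matrix.PosSemidef.abs_sum_mul_div_sqrt_le [DecidableEq ι] {N : Matrix ι ι ℝ}
    (hN : N.PosSemidef) (a : ι → ℝ) (k : ι) :
    |(∑ l, N k l * a l) / Real.sqrt (∑ l, ∑ k, N k l * a k * a l)| ≤ Real.sqrt (N k k) := by
  set q := ∑ l, ∑ k, N k l * a k * a l with hq
  have hq0 : 0 ≤ q := hN.sum_sum_mul_mul_nonneg a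
  by_cases hs : Real.sqrt q = 0
  · simp only [hs, div_zero, abs_zero]
    exact Real.sqrt_nonneg _
  · have hspos : 0 < Real.sqrt q := lt_of_le_of_ne (Real.sqrt_nonneg _) (Ne.symm hs)
    rw [abs_div, abs_of_pos hspos, div_le_iff₀ hspos]
    have hcs := hN.sum_mul_sq_le a k
    rw [← hq] at hcs
    rw [← Real.sqrt_sq_eq_abs, ← Real.sqrt_mul (hN.diag_nonneg) q]
    exact Real.sqrt_le_sqrt hcs

end CauchySchwarz

/-! ### Lower semicontinuity of anisotropic weighted total variations -/

section LowerSemicontinuity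

variable {ι : Type*} [Fintype ι] [DecidableEq ι]

omit [FiniteDimensional ℝ E] [μ.IsAddHaarMeasure] [DecidableEq ι] in
/-- Measurability of the anisotropic slope `√(∑ₖₗ Nₖₗ(y) ∂ₖφ ∂ₗψ)`-type expressions on a set where
the coefficients are continuous. [folklore] -/
theorem aemeasurable_restrict_sum_sum_mul_fderiv {N : E → Matrix ι ι ℝ} {K : Set E}
    (hKm : MeasurableSet K) (hN : ∀ k l, ContinuousOn (fun y ↦ N y k l) K) (b : ι → E)
    (φ ψ : E → ℝ) :
    AEMeasurable (fun y ↦ ∑ l, ∑ k, N y k l * fderiv ℝ φ y (b k) * fderiv ℝ ψ y (b l))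
      (μ.restrict K) := by
  refine Finset.aemeasurable_fun_sum _ fun l _ ↦ Finset.aemeasurable_fun_sum _ fun k _ ↦ ?_
  exact (((hN k l).aemeasurable hKm).mul
    (measurable_fderiv_apply_const ℝ φ (b k)).aemeasurable).mul
    (measurable_fderiv_apply_const ℝ ψ (b l)).aemeasurable

omit [NormedSpace ℝ E] [FiniteDimensional ℝ E] [μ.IsAddHaarMeasure] [DecidableEq ι] in
/-- A function vanishing off a compact set `K`, a.e.-strongly measurable on `K` and bounded there,
is integrable. [folklore] -/
theorem integrable_of_eq_zero_of_bound {Φ : E → ℝ} {K : Set E} (hK : IsCompact K)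
    (hΦK : ∀ y ∉ K, Φ y = 0) (hΦm : AEStronglyMeasurable Φ (μ.restrict K)) {M : ℝ}
    (hΦb : ∀ y ∈ K, |Φ y| ≤ M) [IsFiniteMeasureOnCompacts μ] : Integrable Φ μ := by
  have hind : K.indicator Φ = Φ := by
    funext y
    by_cases hy : y ∈ K
    · rw [indicator_of_mem hy]
    · rw [indicator_of_notMem hy, hΦK y hy]
  rw [← hind, integrable_indicator_iff hK.measurableSet]
  refine ⟨hΦm, .restrict_of_bounded (C := M) hK.measure_lt_top ?_⟩
  filter_upwards [ae_restrict_mem hK.measurableSet] with y hy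
  rw [Real.norm_eq_abs]; exact hΦb y hy

/-- **Lower semicontinuity of the anisotropic weighted total variation under locally uniform
convergence with uniform Lipschitz bounds.** Let `N(y)` be a matrix field, continuous and positive
semidefinite on the open set `O`, `W ≥ 0` a bounded weight, measurable on and vanishing off a
compact `K ⊆ O`, and let `fᵢ, F` be `C`-Lipschitz with `fᵢ → F` locally uniformly on `O`. Then for every
`ε > 0`, eventually
`∫ W √(∑ₖₗ Nₖₗ ∂ₖF ∂ₗF) dμ ≤ ∫ W √(∑ₖₗ Nₖₗ ∂ₖfᵢ ∂ₗfᵢ) dμ + ε`,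
i.e. `∫ W |DF|_N ≤ liminf ∫ W |Dfᵢ|_N`. This is the lower semicontinuity of the total variation
(Giusti 1984, Thm. 1.9; Evans–Gariepy 1992, §5.2, Thm. 1) in the anisotropic, weighted,
Lipschitz setting of Huisken–Ilmanen's Compactness Theorem ("it follows by lower
semicontinuity", J. Differential Geom. 59 (2001), proof of Thm. 2.1, p. 22): read in a chart,
`∫ φ |∇u|_h dμ_h` is such a functional with `N = (hᵏˡ) ∘ φ⁻¹` and `W = (φ √det h) ∘ φ⁻¹`.
Proof by duality with the bounded measurable field `ξ = N DF / |DF|_N` of the *limit*: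
`W |DF|_N = W ∑ₖ ξₖ ∂ₖF = lim ∫ W ∑ₖ ξₖ ∂ₖfᵢ` (weak-* convergence,
`tendsto_integral_sum_mul_fderiv`) and `∑ₖ ξₖ ∂ₖfᵢ ≤ |Dfᵢ|_N` (Cauchy–Schwarz).
[cite: HuiskenIlmanenIMCF2001, §2 proof of Thm. 2.1] -/
theorem integral_mul_sqrt_le_of_tendstoLocallyUniformlyOn (b : ι → E) {N : E → Matrix ι ι ℝ}
    {O K : Set E} (hO : IsOpen O) (hK : IsCompact K) (hKO : K ⊆ O)
    (hN : ∀ k l, ContinuousOn (fun y ↦ N y k l) O) (hNpsd : ∀ y ∈ O, (N y).PosSemidef)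
    {C : ℝ≥0} {f : ℕ → E → ℝ} {F : E → ℝ} (hf : ∀ i, LipschitzWith C (f i))
    (hF : LipschitzWith C F) (hconv : TendstoLocallyUniformlyOn f F atTop O)
    {W : E → ℝ} (hWm : AEMeasurable W (μ.restrict K)) (hW0 : ∀ y, 0 ≤ W y) {B : ℝ}
    (hWb : ∀ y, W y ≤ B) (hWK : ∀ y ∉ K, W y = 0) {ε : ℝ} (hε : 0 < ε) :
    ∀ᶠ i in atTop,
      ∫ y, W y * Real.sqrt (∑ l, ∑ k, N y k l * fderiv ℝ F y (b k) * fderiv ℝ F y (b l)) ∂μ ≤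
        (∫ y, W y * Real.sqrt
          (∑ l, ∑ k, N y k l * fderiv ℝ (f i) y (b k) * fderiv ℝ (f i) y (b l)) ∂μ) + ε := by
  have hKm : MeasurableSet K := hK.measurableSet
  have hNK : ∀ k l, ContinuousOn (fun y ↦ N y k l) K := fun k l ↦ (hN k l).mono hKO
  -- bounds for the coefficients on `K`
  have hbd : ∀ k l, ∃ Λ, 0 ≤ Λ ∧ ∀ y ∈ K, |N y k l| ≤ Λ := by
    intro k l
    obtain ⟨Λ, hΛ⟩ := hK.exists_bound_of_continuousOn (hNK k l)
    exact ⟨max Λ 0, le_max_right _ _, fun y hy ↦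
      (by simpa [Real.norm_eq_abs] using hΛ y hy : |N y k l| ≤ Λ).trans (le_max_left _ _)⟩
  choose Λ hΛ0 hΛ using hbd
  -- bounds for the partial derivatives of `C`-Lipschitz functions
  have hD : ∀ {φ : E → ℝ}, LipschitzWith C φ → ∀ y k, |fderiv ℝ φ y (b k)| ≤ C * ‖b k‖ := by
    intro φ hφ y k
    rw [← Real.norm_eq_abs]
    exact ((fderiv ℝ φ y).le_opNorm (b k)).trans
      (mul_le_mul_of_nonneg_right (norm_fderiv_le_of_lipschitz ℝ hφ) (norm_nonneg _))
  -- the anisotropic slope of a `C`-Lipschitz function is bounded on `K`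
  set Q₀ : ℝ := ∑ l, ∑ k, Λ k l * (C * ‖b k‖) * (C * ‖b l‖) with hQ₀
  have hslope : ∀ {φ : E → ℝ}, LipschitzWith C φ → ∀ y ∈ K,
      |∑ l, ∑ k, N y k l * fderiv ℝ φ y (b k) * fderiv ℝ φ y (b l)| ≤ Q₀ := by
    intro φ hφ y hy
    refine (Finset.abs_sum_le_sum_abs _ _).trans (Finset.sum_le_sum fun l _ ↦ ?_)
    refine (Finset.abs_sum_le_sum_abs _ _).trans (Finset.sum_le_sum fun k _ ↦ ?_)
    rw [abs_mul, abs_mul]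
    exact mul_le_mul (mul_le_mul (hΛ k l y hy) (hD hφ y k) (abs_nonneg _) (hΛ0 k l))
      (hD hφ y l) (abs_nonneg _) (mul_nonneg (hΛ0 k l) (by positivity))
  -- integrability of `W √(slope)` for `C`-Lipschitz functions
  have hWs_int : ∀ {φ : E → ℝ}, LipschitzWith C φ → Integrable (fun y ↦ W y *
      Real.sqrt (∑ l, ∑ k, N y k l * fderiv ℝ φ y (b k) * fderiv ℝ φ y (b l))) μ := by
    intro φ hφ
    refine integrable_of_eq_zero_of_bound hK (fun y hy ↦ by rw [hWK y hy, zero_mul]) ?_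
      (M := B * Real.sqrt Q₀) fun y hy ↦ ?_
    · exact (hWm.mul (Real.continuous_sqrt.measurable.comp_aemeasurable
        (aemeasurable_restrict_sum_sum_mul_fderiv hKm hNK b φ φ))).aestronglyMeasurable
    · rw [abs_mul, abs_of_nonneg (hW0 y), abs_of_nonneg (Real.sqrt_nonneg _)]
      exact mul_le_mul (hWb y) (Real.sqrt_le_sqrt ((le_abs_self _).trans (hslope hφ y hy)))
        (Real.sqrt_nonneg _) ((hW0 y).trans (hWb y))
  -- the optimal field `ξ = N DF / |DF|_N` of the limit and the test functions `Gₖ = W ξₖ`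
  set a : E → ι → ℝ := fun y k ↦ fderiv ℝ F y (b k) with ha
  set sF : E → ℝ := fun y ↦ Real.sqrt (∑ l, ∑ k, N y k l * a y k * a y l) with hsF
  set G : ι → E → ℝ := fun k y ↦ W y * ((∑ l, N y k l * a y l) / sF y) with hG
  have hGK : ∀ k, ∀ y ∉ K, G k y = 0 := fun k y hy ↦ by simp [hG, hWK y hy]
  have hGi : ∀ k, Integrable (G k) μ := by
    intro k
    refine integrable_of_eq_zero_of_bound hK (hGK k) ?_ (M := B * Real.sqrt (Λ k k))
      fun y hy ↦ ?_
    · refine (hWm.mul ((Finset.aemeasurable_fun_sum _ fun l _ ↦ ?_).div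
        (Real.continuous_sqrt.measurable.comp_aemeasurable
          (aemeasurable_restrict_sum_sum_mul_fderiv hKm hNK b F F)))).aestronglyMeasurable
      exact ((hNK k l).aemeasurable hKm).mul (measurable_fderiv_apply_const ℝ F (b l)).aemeasurable
    · rw [hG]
      simp only
      rw [abs_mul, abs_of_nonneg (hW0 y)]
      refine mul_le_mul (hWb y) ?_ (abs_nonneg _) ((hW0 y).trans (hWb y))
      refine ((hNpsd y (hKO hy)).abs_sum_mul_div_sqrt_le (a y) k).trans ?_
      exact Real.sqrt_le_sqrt ((le_abs_self _).trans (hΛ k k y hy))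
  -- pointwise: `∑ₖ Gₖ ∂ₖF = W |DF|_N`
  have hlimit_eq : (fun y ↦ ∑ k, G k y * fderiv ℝ F y (b k)) = fun y ↦ W y * sF y := by
    funext y
    by_cases hy : y ∈ K
    · simp only [hG, mul_assoc, ← Finset.mul_sum]
      rw [(hNpsd y (hKO hy)).sum_div_sqrt_mul_self (a y)]
    · simp [hG, hWK y hy]
  -- pointwise: `∑ₖ Gₖ ∂ₖfᵢ ≤ W |Dfᵢ|_N`
  have hbound : ∀ i y, ∑ k, G k y * fderiv ℝ (f i) y (b k) ≤
      W y * Real.sqrt (∑ l, ∑ k, N y k l * fderiv ℝ (f i) y (b k) * fderiv ℝ (f i) y (b l)) := by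
    intro i y
    by_cases hy : y ∈ K
    · have hsum : ∑ k, G k y * fderiv ℝ (f i) y (b k) =
          W y * ∑ k, (∑ l, N y k l * a y l) / sF y * fderiv ℝ (f i) y (b k) := by
        rw [Finset.mul_sum]
        refine Finset.sum_congr rfl fun k _ ↦ ?_
        simp only [hG]
        ring
      rw [hsum]
      exact mul_le_mul_of_nonneg_left ((hNpsd y (hKO hy)).sum_div_sqrt_mul_le (a y) _) (hW0 y)
    · simp only [hG, hWK y hy, zero_mul, Finset.sum_const_zero]
      exact le_rfl
  -- integrability of `∑ₖ Gₖ ∂ₖfᵢ`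
  have hGD_int : ∀ i, Integrable (fun y ↦ ∑ k, G k y * fderiv ℝ (f i) y (b k)) μ := by
    intro i
    refine integrable_finsetSum _ fun k _ ↦ (hGi k).mul_bdd (c := C * ‖b k‖)
      (measurable_fderiv_apply_const ℝ (f i) (b k)).aestronglyMeasurable ?_
    exact Eventually.of_forall fun y ↦ by rw [Real.norm_eq_abs]; exact hD (hf i) y k
  -- weak-* convergence and conclusion
  have hT := tendsto_integral_sum_mul_fderiv (μ := μ) hO hK hKO hf hF hconv b hGi hGK
  rw [hlimit_eq] at hT
  have hev := (tendsto_order.1 hT).1 _ (sub_lt_self _ hε)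
  filter_upwards [hev] with i hi
  have hmono : ∫ y, ∑ k, G k y * fderiv ℝ (f i) y (b k) ∂μ ≤
      ∫ y, W y * Real.sqrt (∑ l, ∑ k, N y k l * fderiv ℝ (f i) y (b k) *
        fderiv ℝ (f i) y (b l)) ∂μ :=
    integral_mono (hGD_int i) (hWs_int (hf i)) (hbound i)
  have hsF_eq : (fun y ↦ W y * sF y) =
      fun y ↦ W y * Real.sqrt (∑ l, ∑ k, N y k l * fderiv ℝ F y (b k) * fderiv ℝ F y (b l)) := rfl
  rw [hsF_eq] at hi
  linarith

end LowerSemicontinuity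






end Literature.Geometry.Lorentzian
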